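import Mathlib.RingTheory.PowerSeries.Substitution
import Mathlib.Analysis.Normed.Group.Ultra
import Mathlib.Analysis.Normed.Ring.Ultra
import Mathlib.Analysis.Normed.Field.Basic
import HarnessLib

/-!
# Log-type series take congruent arguments to boundedly congruent values: `‖[X^d](ℓ(u) − ℓ(v))‖ ≤ sup_j r^j/‖j‖` for
# `n·[Xⁿ]ℓ` integral and `u ≡ v` to within `r` (Honda 1970 Lemma 2.3 / Hazewinkel I.2.3 / Katz 1981 Lemma 5.1.3, bounded form)

Topic `Literature/RingTheory/FormalGroups` (theorems only; no definition, no named fact, no instance, no `sorry`). Let `K` be a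
non-archimedean normed field, `ℓ ∈ K⟦X⟧` a LOG-TYPE series (`‖n·[Xⁿ]ℓ‖ ≤ 1` for all `n`, e.g. the logarithm of a formal group with integral
coefficients), and `u, v ∈ K⟦X_σ⟧` multivariable series without constant term, `v` integral, `u − v` with coefficients of norm `≤ r`. If
`r^j ≤ M·‖j‖` for all `j ≥ 1` (i.e. `M ≥ sup_j r^j/‖j‖_K`, finite as soon as `r < 1` in a `p`-adic field), then

* ★★ `norm_coeff_subst_sub_subst_le_of_logType` — **`‖[X^d](ℓ(u) − ℓ(v))‖ ≤ M` for every multi-index `d`.**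

The case `r = ‖p‖`, `M = 1` (`σ = Unit`, `K = ℚ_p`) is the tree's `HondaTypeUniqueness.norm_coeff_subst_sub_subst_le_of_natCast_mul_coeff_le`
(`ℓ(u) ≡ ℓ(v) (mod p)`); the general `r` (e.g. `r = ‖ϖ‖` for a uniformiser of a RAMIFIED extension, where `M = sup_j ‖ϖ‖^j/‖j‖` may exceed `1`
but is finite) is the BOUNDED version of Katz's Key Lemma 5.1.3 for log-type series — no divided powers needed. Proof: with `δ = u − v`,
`[Xᵐ]ℓ · (uᵐ − vᵐ) = Σ_{j ≥ 1} [Xᵐ]ℓ·C(m,j)·v^{m−j}δ^j` and `j·[Xᵐ]ℓ·C(m,j) = (m[Xᵐ]ℓ)·C(m−1,j−1)` is integral, so each term has coefficients of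
norm `≤ ‖[Xᵐ]ℓ·C(m,j)‖·r^j ≤ ‖[Xᵐ]ℓ·C(m,j)‖·M‖j‖ ≤ M`.

Also: §1 coefficient bounds for products and powers of multivariable series over an ultrametric field (`norm_coeff_mul_le_mv`,
`norm_coeff_pow_le_mv`).

Purpose (line `kato_lever`, crux K★ `stmt-BirchSwinnertonDyer-22226`, memo `Lines/kato-lever-K2-ramified-cm-transport.md` §5): with
`ℓ = log_{E₀}` and `u = F_{W_D}(X,Y) ≡ v = F_{E₀}(X,Y) (mod ϖ)` it shows that `log_{E₀}` is a function OF THE SECOND KIND on the ramified good model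
`Ŵ_D` (its `⊕_{W_D}`-coboundary has bounded coefficients) — the transport of Dieudonné classes along `W_D ≡ E₀ (mod ϖ)`. BSD / K★ are not proved by
any of this.

## References
* T. Honda, *On the theory of commutative formal groups*, J. Math. Soc. Japan 22 (1970), Lemma 2.3, proof of Thm. 2. [Honda1970]
* M. Hazewinkel, *Formal Groups and Applications* (1978), Ch. I §2.3 (functional equation lemma, part (iv)). [Hazewinkel1978]
* N. M. Katz, *Crystalline cohomology, Dieudonné modules, and Jacobi sums* (1981), Key Lemma 5.1.3. [Katz1981CrystallineDieudonne]
-/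

noncomputable section

open scoped Classical

namespace Literature.RingTheory.FormalGroups

variable {K : Type*} [NormedField K] [IsUltrametricDist K] {σ : Type*}

/-! ## §1 Coefficient bounds for products and powers of multivariable series -/

/-- Coefficients of a product: `‖[X^d](fg)‖ ≤ A·B` if `‖[X^·]f‖ ≤ A`, `‖[X^·]g‖ ≤ B` (ultrametric). [cite: Hazewinkel1978, Ch. I §2.3] -/
theorem norm_coeff_mul_le_mv {f g : MvPowerSeries σ K} {A B : ℝ} (hA : 0 ≤ A) (hB : 0 ≤ B)
    (hf : ∀ d, ‖MvPowerSeries.coeff d f‖ ≤ A) (hg : ∀ d, ‖MvPowerSeries.coeff d g‖ ≤ B) (d : σ →₀ ℕ) :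
    ‖MvPowerSeries.coeff d (f * g)‖ ≤ A * B := by
  rw [MvPowerSeries.coeff_mul]
  refine IsUltrametricDist.norm_sum_le_of_forall_le_of_nonneg (mul_nonneg hA hB) fun ij _ => ?_
  rw [norm_mul]
  exact mul_le_mul (hf _) (hg _) (norm_nonneg _) hA

omit [IsUltrametricDist K] in
/-- Coefficients of `1` have norm `≤ 1`. [folklore] -/
private theorem norm_coeff_one_le_mv (d : σ →₀ ℕ) : ‖MvPowerSeries.coeff d (1 : MvPowerSeries σ K)‖ ≤ 1 := by
  rw [MvPowerSeries.coeff_one]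
  split_ifs
  · rw [norm_one]
  · rw [norm_zero]; exact zero_le_one

/-- Coefficients of a power: `‖[X^d](f^k)‖ ≤ A^k` if `‖[X^·]f‖ ≤ A`. [cite: Hazewinkel1978, Ch. I §2.3] -/
theorem norm_coeff_pow_le_mv {f : MvPowerSeries σ K} {A : ℝ} (hA : 0 ≤ A) (hf : ∀ d, ‖MvPowerSeries.coeff d f‖ ≤ A) (k : ℕ)
    (d : σ →₀ ℕ) : ‖MvPowerSeries.coeff d (f ^ k)‖ ≤ A ^ k := by
  induction k generalizing d with
  | zero => rw [pow_zero, pow_zero]; exact norm_coeff_one_le_mv d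
  | succ k ih => rw [pow_succ, pow_succ]; exact norm_coeff_mul_le_mv (pow_nonneg hA _) hA ih hf d

omit [IsUltrametricDist K] in
/-- `‖n‖ ≤ 1` for natural numbers in an ultrametric field. [folklore] -/
private theorem norm_natCast_le_one' [IsUltrametricDist K] (n : ℕ) : ‖(n : K)‖ ≤ 1 := IsUltrametricDist.norm_natCast_le_one K n

/-! ## §2 The binomial terms `[Xᵐ]ℓ · C(m, j) · v^{m−j} · δ^j` -/

/-- **The denominator is absorbed**: `(j+1) · ([Xᵐ]ℓ · C(m, j+1)) = (m·[Xᵐ]ℓ) · C(m−1, j)`, hence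
`‖(j+1)‖ · ‖[Xᵐ]ℓ · C(m, j+1)‖ ≤ 1` for a log-type `ℓ`. [cite: Honda1970, Lemma 2.3] -/
theorem norm_natCast_succ_mul_coeff_mul_choose_le {ℓ : PowerSeries K} (hℓ : ∀ n : ℕ, ‖(n : K) * PowerSeries.coeff n ℓ‖ ≤ 1)
    {m : ℕ} (hm : 1 ≤ m) (j : ℕ) :
    ‖((j + 1 : ℕ) : K)‖ * ‖PowerSeries.coeff m ℓ * ((m.choose (j + 1) : ℕ) : K)‖ ≤ 1 := by
  obtain ⟨n, rfl⟩ : ∃ n, m = n + 1 := ⟨m - 1, (Nat.sub_add_cancel hm).symm⟩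
  have hid : ((j + 1 : ℕ) : K) * (PowerSeries.coeff (n + 1) ℓ * (((n + 1).choose (j + 1) : ℕ) : K)) =
      (((n + 1 : ℕ) : K) * PowerSeries.coeff (n + 1) ℓ) * ((n.choose j : ℕ) : K) := by
    have h : (n + 1) * n.choose j = (n + 1).choose (j + 1) * (j + 1) := Nat.add_one_mul_choose_eq n j
    -- `(n+1) * C(n, j) = C(n+1, j+1) * (j+1)`
    have h' : ((n + 1 : ℕ) : K) * ((n.choose j : ℕ) : K) = (((n + 1).choose (j + 1) : ℕ) : K) * ((j + 1 : ℕ) : K) := by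
      rw [← Nat.cast_mul, ← Nat.cast_mul, h]
    calc ((j + 1 : ℕ) : K) * (PowerSeries.coeff (n + 1) ℓ * (((n + 1).choose (j + 1) : ℕ) : K))
        = PowerSeries.coeff (n + 1) ℓ * ((((n + 1).choose (j + 1) : ℕ) : K) * ((j + 1 : ℕ) : K)) := by ring
      _ = PowerSeries.coeff (n + 1) ℓ * (((n + 1 : ℕ) : K) * ((n.choose j : ℕ) : K)) := by rw [h']
      _ = (((n + 1 : ℕ) : K) * PowerSeries.coeff (n + 1) ℓ) * ((n.choose j : ℕ) : K) := by ring
  rw [← norm_mul, hid, norm_mul]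
  exact mul_le_one₀ (hℓ (n + 1)) (norm_nonneg _) (norm_natCast_le_one' _)

/-- **One binomial term**: `‖[X^d]([Xᵐ]ℓ · C(m, j+1) · δ^{j+1} · v^{m−1−j})‖ ≤ M` when `‖[X^·]δ‖ ≤ r`, `v` integral and `r^{j+1} ≤ M‖j+1‖`.
[cite: Honda1970, Lemma 2.3] [cite: Katz1981CrystallineDieudonne, Lemma 5.1.3] -/
theorem norm_coeff_logType_binomial_term_le {ℓ : PowerSeries K} (hℓ : ∀ n : ℕ, ‖(n : K) * PowerSeries.coeff n ℓ‖ ≤ 1)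
    {v δ : MvPowerSeries σ K} (hv : ∀ d, ‖MvPowerSeries.coeff d v‖ ≤ 1) {r M : ℝ} (hr : 0 ≤ r) (hM0 : 0 ≤ M)
    (hδ : ∀ d, ‖MvPowerSeries.coeff d δ‖ ≤ r) (hM : ∀ j : ℕ, 1 ≤ j → r ^ j ≤ M * ‖(j : K)‖) {m : ℕ} (hm : 1 ≤ m) (j : ℕ)
    (d : σ →₀ ℕ) :
    ‖MvPowerSeries.coeff d (MvPowerSeries.C (PowerSeries.coeff m ℓ * ((m.choose (j + 1) : ℕ) : K)) *
        (δ ^ (j + 1) * v ^ (m - (j + 1))))‖ ≤ M := by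
  rw [MvPowerSeries.coeff_C_mul, norm_mul]
  have hprod : ‖MvPowerSeries.coeff d (δ ^ (j + 1) * v ^ (m - (j + 1)))‖ ≤ r ^ (j + 1) * 1 :=
    norm_coeff_mul_le_mv (pow_nonneg hr _) zero_le_one (norm_coeff_pow_le_mv hr hδ _)
      (fun d => by simpa using norm_coeff_pow_le_mv zero_le_one hv (m - (j + 1)) d) d
  rw [mul_one] at hprod
  calc ‖PowerSeries.coeff m ℓ * ((m.choose (j + 1) : ℕ) : K)‖ * ‖MvPowerSeries.coeff d (δ ^ (j + 1) * v ^ (m - (j + 1)))‖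
      ≤ ‖PowerSeries.coeff m ℓ * ((m.choose (j + 1) : ℕ) : K)‖ * (M * ‖((j + 1 : ℕ) : K)‖) :=
        mul_le_mul_of_nonneg_left (hprod.trans (hM (j + 1) (Nat.succ_pos j))) (norm_nonneg _)
    _ = M * (‖((j + 1 : ℕ) : K)‖ * ‖PowerSeries.coeff m ℓ * ((m.choose (j + 1) : ℕ) : K)‖) := by ring
    _ ≤ M * 1 := mul_le_mul_of_nonneg_left (norm_natCast_succ_mul_coeff_mul_choose_le hℓ hm j) hM0
    _ = M := mul_one M

omit [IsUltrametricDist K] in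
/-- **`[Xᵐ]ℓ · ((v + δ)ᵐ − vᵐ) = Σ_{j<m} [Xᵐ]ℓ·C(m, j+1)·δ^{j+1}v^{m−1−j}`** (binomial theorem minus the `j = 0` term).
[cite: Honda1970, Lemma 2.3] -/
theorem C_coeff_mul_add_pow_sub_pow (ℓ : PowerSeries K) (v δ : MvPowerSeries σ K) (m : ℕ) :
    MvPowerSeries.C (PowerSeries.coeff m ℓ) * ((δ + v) ^ m - v ^ m) =
      ∑ j ∈ Finset.range m, MvPowerSeries.C (PowerSeries.coeff m ℓ * ((m.choose (j + 1) : ℕ) : K)) * (δ ^ (j + 1) * v ^ (m - (j + 1))) := by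
  rw [add_pow, Finset.sum_range_succ', pow_zero, one_mul, Nat.sub_zero, Nat.choose_zero_right, Nat.cast_one, mul_one, add_sub_cancel_right,
    Finset.mul_sum]
  refine Finset.sum_congr rfl fun j _ => ?_
  rw [map_mul, map_natCast]
  ring

/-! ## §3 The main estimate -/

/-- ★★ **Log-type series take `r`-congruent arguments to `M`-congruent values** (`M ≥ sup_{j≥1} r^j/‖j‖`): for `ℓ ∈ K⟦X⟧` with
`‖n·[Xⁿ]ℓ‖ ≤ 1`, multivariable `u, v` without constant term, `v` integral and `‖[X^·](u − v)‖ ≤ r`, every coefficient of `ℓ(u) − ℓ(v)` has norm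
`≤ M`. (Honda's Lemma 2.3 / Hazewinkel I.2.3 for `r = ‖p‖`, `M = 1`; Katz's Key Lemma 5.1.3 in bounded form for general `r`, e.g. `r = ‖ϖ‖` over a
RAMIFIED base.) [cite: Honda1970, Lemma 2.3] [cite: Hazewinkel1978, Ch. I §2.3] [cite: Katz1981CrystallineDieudonne, Lemma 5.1.3] -/
theorem norm_coeff_subst_sub_subst_le_of_logType {ℓ : PowerSeries K} (hℓ : ∀ n : ℕ, ‖(n : K) * PowerSeries.coeff n ℓ‖ ≤ 1)
    {u v : MvPowerSeries σ K} (hu0 : MvPowerSeries.constantCoeff u = 0) (hv0 : MvPowerSeries.constantCoeff v = 0)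
    (hv : ∀ d, ‖MvPowerSeries.coeff d v‖ ≤ 1) {r M : ℝ} (hr : 0 ≤ r) (hM0 : 0 ≤ M)
    (huv : ∀ d, ‖MvPowerSeries.coeff d (u - v)‖ ≤ r) (hM : ∀ j : ℕ, 1 ≤ j → r ^ j ≤ M * ‖(j : K)‖) (d : σ →₀ ℕ) :
    ‖MvPowerSeries.coeff d (ℓ.subst u - ℓ.subst v)‖ ≤ M := by
  have hsu : PowerSeries.HasSubst u := PowerSeries.HasSubst.of_constantCoeff_zero hu0
  have hsv : PowerSeries.HasSubst v := PowerSeries.HasSubst.of_constantCoeff_zero hv0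
  have hfu := PowerSeries.coeff_subst_finite hsu ℓ d
  have hfv := PowerSeries.coeff_subst_finite hsv ℓ d
  rw [map_sub, PowerSeries.coeff_subst hsu ℓ d, PowerSeries.coeff_subst hsv ℓ d, ← finsum_sub_distrib hfu hfv]
  have hfin : (Function.support fun m : ℕ =>
      PowerSeries.coeff m ℓ • MvPowerSeries.coeff d (u ^ m) - PowerSeries.coeff m ℓ • MvPowerSeries.coeff d (v ^ m)).Finite :=
    (hfu.union hfv).subset (Function.support_sub _ _)
  rw [finsum_eq_sum _ hfin]
  refine IsUltrametricDist.norm_sum_le_of_forall_le_of_nonneg hM0 fun m _ => ?_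
  -- the `m`-th term: `[Xᵐ]ℓ · [X^d](uᵐ − vᵐ)`
  rcases Nat.eq_zero_or_pos m with rfl | hm
  · rw [pow_zero, pow_zero, sub_self, norm_zero]; exact hM0
  have hδ : ∀ d', ‖MvPowerSeries.coeff d' (u - v)‖ ≤ r := huv
  have hterm : PowerSeries.coeff m ℓ • MvPowerSeries.coeff d (u ^ m) - PowerSeries.coeff m ℓ • MvPowerSeries.coeff d (v ^ m) =
      MvPowerSeries.coeff d (MvPowerSeries.C (PowerSeries.coeff m ℓ) * (((u - v) + v) ^ m - v ^ m)) := by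
    rw [sub_add_cancel, MvPowerSeries.coeff_C_mul, map_sub, smul_eq_mul, smul_eq_mul, mul_sub]
  rw [hterm, C_coeff_mul_add_pow_sub_pow, map_sum]
  refine IsUltrametricDist.norm_sum_le_of_forall_le_of_nonneg hM0 fun j _ => ?_
  exact norm_coeff_logType_binomial_term_le hℓ hv hr hM0 hδ hM hm j d

/-- The one-variable case (`σ = Unit`), for convenience. [cite: Honda1970, Lemma 2.3] [cite: Katz1981CrystallineDieudonne, Lemma 5.1.3] -/
theorem norm_coeff_subst_sub_subst_le_of_logType' {ℓ : PowerSeries K} (hℓ : ∀ n : ℕ, ‖(n : K) * PowerSeries.coeff n ℓ‖ ≤ 1)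
    {u v : PowerSeries K} (hu0 : PowerSeries.constantCoeff u = 0) (hv0 : PowerSeries.constantCoeff v = 0)
    (hv : ∀ n, ‖PowerSeries.coeff n v‖ ≤ 1) {r M : ℝ} (hr : 0 ≤ r) (hM0 : 0 ≤ M)
    (huv : ∀ n, ‖PowerSeries.coeff n (u - v)‖ ≤ r) (hM : ∀ j : ℕ, 1 ≤ j → r ^ j ≤ M * ‖(j : K)‖) (n : ℕ) :
    ‖PowerSeries.coeff n (ℓ.subst u - ℓ.subst v)‖ ≤ M := by
  have key : ∀ (w : PowerSeries K) (d : Unit →₀ ℕ), MvPowerSeries.coeff d w = PowerSeries.coeff (d ()) w := fun w d => by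
    rw [PowerSeries.coeff_def (s := d) rfl]
  have h := norm_coeff_subst_sub_subst_le_of_logType (σ := Unit) hℓ hu0 hv0 (fun d => by rw [key]; exact hv _) hr hM0
    (fun d => by rw [key]; exact huv _) hM (Finsupp.single () n)
  rwa [key, Finsupp.single_eq_same] at h

end Literature.RingTheory.FormalGroups
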